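/-
Copyright (c) 2026 the pub-hodgecm-mathlib formalisation cell (harness21).  Prover seat hodgecm-mathlib-K2E3-p03 (g6), Track B «K2-LIT» ∕ h413
(`stmt-HodgeConjecture-24833`), line `K2_E3_EllipticInputs`, road (11-3-split-nsc), leaf (nsc-S-A′) `sig_K2E3GL3PrincipalBlockStandardSpan` (owner K2E3-p25 (g0)),
line «IH-x×x×x» (lead K2E3-p03 (g6) by D78; dealer K2E3-plan (g4)), brick IH-2a: THE RANK-ONE CELL MOVES BEHIND THE IWAHORI–HECKE OPERATORS `T_s` ON `GL_n(F)`.  2026-09-04.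
-/
import Summits.HodgeConjecture.HodgeConjecture.Theorems.K2E3GL3IwahoriBruhat        -- ★ IH-1 (this seat): reduction mod 𝓂 ∕ `Iw` lemmas, `inducingChar_apply_eq_one_of_conj_mem_iwahori`
import Literature.NumberTheory.Automorphic.WhittakerSupportFinite                   -- ★ `transvectionUnit i j hij c : GL (Fin n) R` (`1 + c E_{ij}`), `coe_transvectionUnit`, `transvectionUnit_inv∕_zero`
import Literature.NumberTheory.Automorphic.InducedWhittakerVanishing                 -- ★ `permGL_inv`, `permGL_one`, `coe_permGL_mul_mul_inv` (`(P_σ g P_σ⁻¹)_{ab} = g_{σ a, σ b}`)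
import Literature.NumberTheory.Automorphic.BorelBruhatCellsGK                        -- ★ `permGL_mul_diagonalGL_mul_permGL_inv`, `diagonalGL_mem_borel`
import Literature.NumberTheory.Automorphic.ParabolicInductionProofs                  -- ★ `rootDeltaChar_eq_one_of_mem_unipotentRadicalP`
import HarnessLib

/-!
# K2_E3 road (h413), leaf (nsc-S-A′), line «IH-x×x×x», brick IH-2a: the rank-one cell moves `P_w · u_{ij}(x) · P_s ∈ B · P_? · Iw` behind the Iwahori–Hecke
# operators, the `Iw ∕ (Iw ∩ P_s Iw P_s⁻¹)`-transversal `{u_{i,i+1}(x̃) : x ∈ 𝓀}`, and the resulting VALUES `f(P_w u P_s)`, `f(P_w d P_c)` of vectors of `Ind_B^{GL_n} σ′`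

Cell `pub/hodgecm-mathlib` (D-0151), Track B, seat K2E3-p03 (g6), LEAD of line «IH-x×x×x» (dealer D78); architect K2E3-p25 (g0) `MEMO-H4-residues.v1` §2 route (H).
`--supports stmt-HodgeConjecture-24833 --as helper`; THEOREMS ONLY (no definition ∕ instance ∕ notation ∕ named fact ∕ `sorry`); never imports `Cruxes/…/Lines`.
COUNT-NEUTRAL helper, GENERIC in `n`; the sequel IH-2b (`K2E3GL3IwahoriHeckeOperators`) turns these pointwise values into the operators `T_{s₁}, T_{s₂}, R` on
`I(χ)^{Iw} ≃ (S_n → ℂ)` (★ IH-1 `exists_fixedPoints_iwahori_linearEquiv_eval`) and, at `n = 3`, into K2E3-p11 (g6)'s literal matrices of ★ IH-4 `K2E3GL3IwahoriModuleIrreducible`.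

NOTATION (inline).  `B = standardParabolicGL F id`, `Iw = iwahoriGL n F`, `P_w = permGL w` (`(P_w)_{ab} = [w a = b]`, `P_ρ P_σ = P_{σρ}`), `u_{ij}(x) = transvectionUnit i j _ x
= 1 + x E_{ij}`, `s = Equiv.swap i j`, `𝓀 = 𝓀[F]`, `x̃ = liftRes x`.

THE MATHEMATICS [IwahoriMatsumoto1965, §3 (the relations of `ℋ(G, B)`); BruhatTits1972, (4.4.3)–(4.4.4); Casselman1980, §3; Borel1976, §3–§4].  Everything is driven by ONE
conjugation rule and ONE rank-one identity:
* §1 `P_w u_{ij}(x) P_w⁻¹ = u_{w⁻¹ i, w⁻¹ j}(x)` (`permGL_mul_transvectionUnit_mul_permGL_inv`); memberships `u_{ij}(x) ∈ U ≤ B` (`i < j`), `∈ GL_n(𝒪)` (`x ∈ 𝒪`), `∈ Iw`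
  (`i < j`, `x ∈ 𝒪`); the diagonal entries of an element of `Iw` are UNITS (`valuation_apply_diag_eq_one_of_mem_iwahori`); for `j = i + 1` and `m ∈ Iw`:
  `P_s⁻¹ m P_s ∈ Iw ↔ |m_{ij}| < 1` (`conj_swap_mem_iwahori_iff`).
* §2 CASE A (`w⁻¹ i < w⁻¹ j`): `P_w u_{ij}(x) P_s = u_{w⁻¹i, w⁻¹j}(x) · P_{sw}` with the first factor in `U`; CASE B (`w⁻¹ j < w⁻¹ i`, `x ∈ 𝒪ˣ`):
  `P_w u_{ij}(x) P_s = u_{w⁻¹j, w⁻¹i}(x⁻¹) · P_w · κ(x)`, `κ(x) = u_{ji}(−x⁻¹) u_{ij}(x) P_s ∈ Iw` (the rank-one identity `u_{ji}(x⁻¹) u_{ji}(−x⁻¹) = 1` conjugated by `P_w`;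
  `κ(x)` is the integral upper triangular `[[x, 1], [0, −x⁻¹]]` in the `(i, j)`-plane: `coe_kappa_apply_eq_zero`); and `P_w · diag(d) · P_c = diag(d ∘ w) · P_{cw}`.
* §3 VALUES for `f ∈ Ind_B σ′`, `σ′ = (χ ∘ levi)·δ_B^{1∕2}` (★ `parabolicIndGL F id (𝟙.twist χ)`), any `χ`: CASE A `f(P_w u_{ij}(x) P_s) = f(P_{sw})` (`σ′|_U = 1` ★); CASE B for `f`
  `Iw`-FIXED and `x ∈ 𝒪ˣ`: `f(P_w u_{ij}(x) P_s) = f(P_w)`; `x = 0`: `f(P_w P_s) = f(P_{sw})`; torus move `f(P_w diag(d) P_c) = σ′(diag(d ∘ w)) · f(P_{cw})`.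
* §4 THE TRANSVERSAL (`j = i + 1`): `R₀ = {u_{ij}(x̃) : x ∈ 𝓀}` is a left transversal of `Iw ∕ (Iw ∩ P_s Iw P_s⁻¹)` (★ `IsLeftTransversal`, CompactOpenAveraging) with `#R₀ = q = |𝓀|`
  — the `q` left cosets of `Iw s Iw ∕ Iw`; this is what turns ★ `Representation.avgProj Iw ∘ π(P_s)` into `q⁻¹ · Σ_{x ∈ 𝓀} π(u_{ij}(x̃) P_s)` in IH-2b.
HONEST LABEL: HC_CM is proved only modulo the 7 printed citations (2 remaining named inputs: hLiu418 = stmt-HodgeConjecture-24832, h413 = stmt-HodgeConjecture-24833)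
until rung 0 closes; count-neutral helper (structure theory; no printed citation is discharged).

## Mathlib ∕ tree search
Tree ★: `transvectionUnit` kit (WhittakerSupportFinite) · `permGL_inv`∕`permGL_one`∕`coe_permGL_mul_mul_inv` (InducedWhittakerVanishing) · `permGL_mul_permGL` (ParabolicBruhatCellsGL) ·
`permGL_mul_diagonalGL_mul_permGL_inv`∕`diagonalGL_mem_borel`∕`upperUnitriangular_le_borel` (BorelBruhatCellsGK) · `rootDeltaChar_eq_one_of_mem_unipotentRadicalP` · `liftRes` kit,
`mem_glInt_of_isIntegralMatrix`, `permGL_mem_glInt` (HeckeTransversalGL) · `IsLeftTransversal` (CompactOpenAveraging) · ★ IH-1 `glIntReduction_mem_borel_of_mem_iwahori`.  Mathlib: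
`Matrix.transvection_mul_apply_same∕_of_ne`, `det_transvection_of_ne`, `Equiv.swap_apply_*`, `Finset.card_image_of_injective`.  Dedup: `rg "conj_swap_mem_iwahori|kappa_mem_iwahori"` — none.

## References
* [IwahoriMatsumoto1965] N. Iwahori, H. Matsumoto, Publ. Math. IHÉS 25 (1965), §2–§3.  * [BruhatTits1972] F. Bruhat, J. Tits, Publ. Math. IHÉS 41 (1972), (4.4.3)–(4.4.4).
* [Casselman1980] W. Casselman, Compositio Math. 40 (1980), §3.  * [Borel1976] A. Borel, Invent. Math. 35 (1976), §3–§4.  * [CartierCorvallis1979] P. Cartier, PSPM 33.1 (1979), §IV.1.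
-/

set_option autoImplicit false
-- the mandated namespace repeats the single-problem summit's segment (`HodgeConjecture.HodgeConjecture`)
set_option linter.dupNamespace false

noncomputable section

open Matrix
open scoped MatrixGroups
open Literature.NumberTheory.Automorphic ValuativeRel
open Summit.HodgeConjecture.HodgeConjecture.Cruxes.H413

namespace Summit.HodgeConjecture.HodgeConjecture.Cruxes.H413.K2E3GLnIwahoriHeckeCells

universe u
/-! ## §1 Transvections: conjugation by permutation matrices, memberships, and the `P_s`-conjugate of `Iw` -/

section Transvections
variable {F : Type u} [Field F] {n : ℕ}
/-- **`P_w u_{ij}(x) P_w⁻¹ = u_{w⁻¹ i, w⁻¹ j}(x)`** (★ `(P_σ g P_σ⁻¹)_{ab} = g_{σ a, σ b}`). [cite: IwahoriMatsumoto1965, §2] -/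
theorem permGL_mul_transvectionUnit_mul_permGL_inv (w : Equiv.Perm (Fin n)) {i j : Fin n} (hij : i ≠ j) (x : F) :
    (permGL w : GL (Fin n) F) * transvectionUnit i j hij x * (permGL w)⁻¹ =
      transvectionUnit (w⁻¹ i) (w⁻¹ j) (fun h => hij (w⁻¹.injective h)) x := by
  refine Units.ext ?_
  rw [coe_permGL_mul_mul_inv, coe_transvectionUnit, coe_transvectionUnit]
  ext a b
  simp only [Matrix.submatrix_apply, Matrix.add_apply, Matrix.one_apply, Matrix.single_apply, EmbeddingLike.apply_eq_iff_eq,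
    Equiv.Perm.inv_def, Equiv.symm_apply_eq]

/-- `u_{ij}(x) ∈ U_n` (upper unitriangular) for `i < j`. [cite: BernsteinZelevinsky1977, §2.1] -/
theorem transvectionUnit_mem_upperUnitriangular {i j : Fin n} (hij : i < j) (x : F) :
    transvectionUnit i j hij.ne x ∈ upperUnitriangular (Fin n) F := by
  rw [mem_upperUnitriangular_iff, coe_transvectionUnit]
  refine ⟨fun a b hba => ?_, fun a => ?_⟩
  · have hba' : b < a := hba
    rw [Matrix.add_apply, Matrix.one_apply_ne (ne_of_gt hba'), Matrix.single_apply_of_ne, add_zero]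
    rintro ⟨rfl, rfl⟩
    exact lt_asymm hij hba'
  · rw [Matrix.add_apply, Matrix.one_apply_eq, Matrix.single_apply_of_ne, add_zero]
    rintro ⟨rfl, rfl⟩
    exact lt_irrefl _ hij

/-- `u_{ij}(x) ∈ B` for `i < j`. [cite: BernsteinZelevinsky1977, §2.1] -/
theorem transvectionUnit_mem_borel {i j : Fin n} (hij : i < j) (x : F) :
    transvectionUnit i j hij.ne x ∈ standardParabolicGL F (id : Fin n → Fin n) :=
  upperUnitriangular_le_borel (transvectionUnit_mem_upperUnitriangular hij x)

variable [ValuativeRel F]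
/-- `u_{ij}(x) ∈ GL_n(𝒪)` for `x ∈ 𝒪` (integral entries, `det = 1`). [cite: IwahoriMatsumoto1965, §2] -/
theorem transvectionUnit_mem_glInt {i j : Fin n} (hij : i ≠ j) {x : F} (hx : x ∈ 𝒪[F]) :
    transvectionUnit i j hij x ∈ glInt n F := by
  refine mem_glInt_of_isIntegralMatrix (fun a b => ?_) ?_
  · rw [coe_transvectionUnit, Matrix.add_apply]
    refine add_mem ?_ ?_
    · rw [Matrix.one_apply]; split_ifs; exacts [one_mem _, zero_mem _]
    · rw [Matrix.single_apply]; split_ifs; exacts [hx, zero_mem _]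
  · rw [coe_transvectionUnit, ← Matrix.transvection, Matrix.det_transvection_of_ne _ _ hij, map_one]

/-- `u_{ij}(x) ∈ Iw` for `i < j` and `x ∈ 𝒪`. [cite: IwahoriMatsumoto1965, §2 Prop. 2.4] -/
theorem transvectionUnit_mem_iwahori {i j : Fin n} (hij : i < j) {x : F} (hx : x ∈ 𝒪[F]) :
    transvectionUnit i j hij.ne x ∈ iwahoriGL n F := by
  rw [mem_iwahoriGL_iff]
  refine ⟨transvectionUnit_mem_glInt hij.ne hx, fun a b hba => ?_⟩
  rw [((mem_upperUnitriangular_iff _).1 (transvectionUnit_mem_upperUnitriangular hij x)).1 hba, map_zero]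
  exact zero_lt_one

/-- **The diagonal entries of an element of `Iw` are units**: the reduction of `k` is an invertible upper triangular matrix over `𝓀`, whose diagonal entries are non-zero
(`det = ∏ diag`). [cite: IwahoriMatsumoto1965, §2 Prop. 2.4] -/
theorem valuation_apply_diag_eq_one_of_mem_iwahori {k : GL (Fin n) F} (hk : k ∈ iwahoriGL n F) (a : Fin n) :
    valuation F ((k : Matrix (Fin n) (Fin n) F) a a) = 1 := by
  have hkint : k ∈ glInt n F := iwahoriGL_le_glInt n F hk
  have hβ := K2E3GL3IwahoriBruhat.glIntReduction_mem_borel_of_mem_iwahori hk hkint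
  set β := glIntReduction n F ⟨k, hkint⟩ with hβdef
  have hβtri : (β : Matrix (Fin n) (Fin n) 𝓀[F]).BlockTriangular id := (mem_standardParabolicGL_iff _ β).1 hβ
  have hdet : (β : Matrix (Fin n) (Fin n) 𝓀[F]).det ≠ 0 := by
    rw [← Matrix.GeneralLinearGroup.val_det_apply]
    exact (Units.isUnit _).ne_zero
  have hdiag : (β : Matrix (Fin n) (Fin n) 𝓀[F]) a a ≠ 0 := by
    intro h0
    apply hdet
    rw [Matrix.det_of_upperTriangular hβtri]
    exact Finset.prod_eq_zero (Finset.mem_univ a) h0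
  have hle : valuation F ((k : Matrix (Fin n) (Fin n) F) a a) ≤ 1 := valuation_apply_le_one_of_mem_glInt hkint a a
  refine le_antisymm hle (not_lt.1 fun hlt => hdiag ?_)
  rw [hβdef]
  exact (glIntReduction_apply_eq_zero_iff ⟨k, hkint⟩ a a).2 hlt

/-- For the ADJACENT transposition `s = (i, i+1)` and `m ∈ Iw`: **`P_s⁻¹ m P_s ∈ Iw ↔ |m_{i,i+1}| < 1`** (conjugation by `P_s` swaps the entries `(i, i+1) ↔ (i+1, i)` and
preserves the strict lower triangle otherwise). [cite: IwahoriMatsumoto1965, §3] [cite: BruhatTits1972, (4.4.4)] -/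
theorem conj_swap_mem_iwahori_iff {i j : Fin n} (hij : (j : ℕ) = i + 1) {m : GL (Fin n) F} (hm : m ∈ iwahoriGL n F) :
    (permGL (Equiv.swap i j) : GL (Fin n) F)⁻¹ * m * permGL (Equiv.swap i j) ∈ iwahoriGL n F ↔
      valuation F ((m : Matrix (Fin n) (Fin n) F) i j) < 1 := by
  have hij' : i < j := Fin.lt_def.2 (by omega)
  have hne : i ≠ j := hij'.ne
  have hmint : m ∈ glInt n F := iwahoriGL_le_glInt n F hm
  -- the conjugate and its entries
  have hconj : (permGL (Equiv.swap i j) : GL (Fin n) F)⁻¹ * m * permGL (Equiv.swap i j) =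
      permGL (Equiv.swap i j) * m * (permGL (Equiv.swap i j))⁻¹ := by
    rw [permGL_inv, Equiv.swap_inv]
  have hentry : ∀ a b, (((permGL (Equiv.swap i j) : GL (Fin n) F)⁻¹ * m * permGL (Equiv.swap i j) : GL (Fin n) F) :
      Matrix (Fin n) (Fin n) F) a b = (m : Matrix (Fin n) (Fin n) F) (Equiv.swap i j a) (Equiv.swap i j b) := by
    intro a b
    rw [hconj, coe_permGL_mul_mul_inv, Matrix.submatrix_apply]
  have hint : (permGL (Equiv.swap i j) : GL (Fin n) F)⁻¹ * m * permGL (Equiv.swap i j) ∈ glInt n F :=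
    mul_mem (mul_mem (inv_mem (permGL_mem_glInt _)) hmint) (permGL_mem_glInt _)
  rw [mem_iwahoriGL_iff]
  constructor
  · rintro ⟨-, h⟩
    have := h j i hij'
    rwa [hentry, Equiv.swap_apply_right, Equiv.swap_apply_left] at this
  · intro hlt
    refine ⟨hint, fun a b hba => ?_⟩
    rw [hentry]
    by_cases hab : a = j ∧ b = i
    · obtain ⟨rfl, rfl⟩ := hab
      rwa [Equiv.swap_apply_right, Equiv.swap_apply_left]
    · -- otherwise `swap b < swap a`, and the Iwahori condition of `m` applies
      refine ((mem_iwahoriGL_iff m).1 hm).2 _ _ ?_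
      have hba' : (b : ℕ) < a := Fin.lt_def.1 hba
      rw [Fin.lt_def, Equiv.swap_apply_def, Equiv.swap_apply_def]
      have hi : (i : ℕ) + 1 = j := hij.symm
      split_ifs with h1 h2 h3 h4 h5 h6 h7 h8 <;> simp only [Fin.ext_iff] at * <;> omega
end Transvections

/-! ## §2 The cell moves: CASE A, CASE B (rank one), `x = 0`, and the torus move `P_w diag(d) P_c` -/

section Cells
variable {F : Type u} [Field F] {n : ℕ}
/-- **CASE A**: for `w⁻¹ i < w⁻¹ j`, `P_w u_{ij}(x) P_s = u_{w⁻¹ i, w⁻¹ j}(x) · P_{s w}` with the first factor in `U_n ≤ B` (`s = (i j)`). [cite: IwahoriMatsumoto1965, §3] -/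
theorem permGL_mul_transvectionUnit_mul_permGL_swap_of_lt (w : Equiv.Perm (Fin n)) {i j : Fin n} (hij : i ≠ j) (x : F) :
    (permGL w : GL (Fin n) F) * transvectionUnit i j hij x * permGL (Equiv.swap i j) =
      transvectionUnit (w⁻¹ i) (w⁻¹ j) (fun h => hij (w⁻¹.injective h)) x * permGL (Equiv.swap i j * w) := by
  rw [← permGL_mul_transvectionUnit_mul_permGL_inv w hij x, ← permGL_mul_permGL]
  group

/-- **CASE B (the rank-one identity)**: for `x ≠ 0`, `P_w u_{ij}(x) P_s = u_{w⁻¹ j, w⁻¹ i}(x⁻¹) · P_w · κ(x)` with `κ(x) = u_{ji}(−x⁻¹) u_{ij}(x) P_s` — nothing but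
`u_{ji}(x⁻¹) u_{ji}(−x⁻¹) = 1` conjugated by `P_w`; the point (§1∕below) is that the first factor is in `U` when `w⁻¹ j < w⁻¹ i` and `κ(x) ∈ Iw` when `x ∈ 𝒪ˣ`.
[cite: BruhatTits1972, (4.4.4)] [cite: IwahoriMatsumoto1965, §3] -/
theorem permGL_mul_transvectionUnit_mul_permGL_swap_eq_rankOne (w : Equiv.Perm (Fin n)) {i j : Fin n} (hij : i ≠ j) {x : F} :
    (permGL w : GL (Fin n) F) * transvectionUnit i j hij x * permGL (Equiv.swap i j) =
      transvectionUnit (w⁻¹ j) (w⁻¹ i) (fun h => hij (w⁻¹.injective h).symm) x⁻¹ * permGL w *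
        (transvectionUnit j i hij.symm (-x⁻¹) * transvectionUnit i j hij x * permGL (Equiv.swap i j)) := by
  rw [← permGL_mul_transvectionUnit_mul_permGL_inv w hij.symm x⁻¹, ← transvectionUnit_inv j i hij.symm x⁻¹]
  group

/-- **The entries of `κ(x) = u_{ji}(−x⁻¹) u_{ij}(x) P_s` below the diagonal vanish** (`i < j`, `x ≠ 0`): `κ(x)` is the identity outside the `(i, j)`-plane, where it is
`[[x, 1], [0, −x⁻¹]]` (row `i ↦ x e_i + e_j`, row `j ↦ −x⁻¹ e_j`). [cite: BruhatTits1972, (4.4.4)] -/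
theorem coe_kappa_apply_eq_zero {i j : Fin n} (hij : i < j) {x : F} (hx : x ≠ 0) {a b : Fin n} (hba : b < a) :
    (((transvectionUnit j i hij.ne' (-x⁻¹) * transvectionUnit i j hij.ne x * permGL (Equiv.swap i j) : GL (Fin n) F)) :
      Matrix (Fin n) (Fin n) F) a b = 0 := by
  have hP : ∀ c d : Fin n, ((permGL (Equiv.swap i j) : GL (Fin n) F) : Matrix (Fin n) (Fin n) F) c d = if Equiv.swap i j c = d then 1 else 0 :=
    fun c d => by rw [coe_permGL, permMatrix_apply']
  rw [Units.val_mul, Units.val_mul, coe_transvectionUnit, coe_transvectionUnit, ← Matrix.transvection, ← Matrix.transvection, Matrix.mul_assoc]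
  by_cases ha : a = j
  · subst ha
    rw [Matrix.transvection_mul_apply_same, Matrix.transvection_mul_apply_of_ne (ha := hij.ne'), Matrix.transvection_mul_apply_same]
    simp only [hP, Equiv.swap_apply_right, Equiv.swap_apply_left, if_neg (ne_of_gt hba)]
    by_cases hb : i = b
    · rw [if_pos hb]; field_simp; ring
    · rw [if_neg hb]; ring
  · rw [Matrix.transvection_mul_apply_of_ne (ha := ha)]
    by_cases ha' : a = i
    · subst ha'
      rw [Matrix.transvection_mul_apply_same]
      simp only [hP, Equiv.swap_apply_left, Equiv.swap_apply_right, if_neg (ne_of_gt (lt_trans hba hij)), if_neg (ne_of_gt hba)]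
      ring
    · rw [Matrix.transvection_mul_apply_of_ne (ha := ha'), hP, Equiv.swap_apply_of_ne_of_ne ha' ha, if_neg (ne_of_gt hba)]

/-- `P_w P_s = P_{s w}` (the `x = 0` term: `u_{ij}(0) = 1`). [cite: IwahoriMatsumoto1965, §3] -/
theorem permGL_mul_transvectionUnit_zero_mul_permGL_swap (w : Equiv.Perm (Fin n)) {i j : Fin n} (hij : i ≠ j) :
    (permGL w : GL (Fin n) F) * transvectionUnit i j hij (0 : F) * permGL (Equiv.swap i j) = permGL (Equiv.swap i j * w) := by
  rw [transvectionUnit_zero, mul_one, permGL_mul_permGL]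

/-- **The torus move `P_w · diag(d) · P_c = diag(d ∘ w) · P_{c w}`** (★ `P_w diag(d) P_w⁻¹ = diag(d ∘ w)`). [cite: IwahoriMatsumoto1965, §3] -/
theorem permGL_mul_diagonalGL_mul_permGL (w c : Equiv.Perm (Fin n)) (d : Fin n → Fˣ) :
    (permGL w : GL (Fin n) F) * diagonalGL (Fin n) F d * permGL c = diagonalGL (Fin n) F (d ∘ w) * permGL (c * w) := by
  rw [← permGL_mul_diagonalGL_mul_permGL_inv w d, ← permGL_mul_permGL]
  group

variable [ValuativeRel F]
/-- **`κ(x) ∈ Iw` for `x ∈ 𝒪ˣ`** (`i < j`): integral (three integral factors, `x⁻¹ ∈ 𝒪`) and upper triangular (`coe_kappa_apply_eq_zero`). [cite: BruhatTits1972, (4.4.4)] -/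
theorem kappa_mem_iwahori {i j : Fin n} (hij : i < j) {x : F} (hx : valuation F x = 1) :
    transvectionUnit j i hij.ne' (-x⁻¹) * transvectionUnit i j hij.ne x * permGL (Equiv.swap i j) ∈ iwahoriGL n F := by
  have hx0 : x ≠ 0 := fun h => by rw [h, map_zero] at hx; exact zero_ne_one hx
  have hxO : x ∈ 𝒪[F] := (Valuation.mem_integer_iff _ _).2 hx.le
  have hxiO : -x⁻¹ ∈ 𝒪[F] := by
    refine neg_mem ((Valuation.mem_integer_iff _ _).2 ?_)
    rw [map_inv₀, hx, inv_one]
  rw [mem_iwahoriGL_iff]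
  refine ⟨mul_mem (mul_mem (transvectionUnit_mem_glInt hij.ne' hxiO) (transvectionUnit_mem_glInt hij.ne hxO)) (permGL_mem_glInt _),
    fun a b hba => ?_⟩
  rw [coe_kappa_apply_eq_zero hij hx0 hba, map_zero]
  exact zero_lt_one
end Cells

/-! ## §3 Values of vectors of `Ind_B^{GL_n} σ′`, `σ′ = (χ ∘ levi) · δ_B^{1∕2}`, at the moved points -/

section Values
variable {F : Type} [Field F] [ValuativeRel F] [TopologicalSpace F] [IsNonarchimedeanLocalField F] {n : ℕ}
  (χ : (Π a : Fin n, GL {i : Fin n // (id : Fin n → Fin n) i = a} F) →* ℂˣ)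
/-- `σ′(u) = 1` on `U_n` (`levi u = 1`, `δ_B^{1∕2}|_U = 1` ★ `rootDeltaChar_eq_one_of_mem_unipotentRadicalP`), any `χ`. [cite: BernsteinZelevinsky1977, 1.7 and §1.9] -/
theorem inducingChar_eq_one_of_mem_upperUnitriangular {u : GL (Fin n) F} (hu : u ∈ upperUnitriangular (Fin n) F) :
    Representation.twist (((Representation.trivial ℂ (Π a : Fin n, GL {i : Fin n // (id : Fin n → Fin n) i = a} F) ℂ).twist χ).comp
      (leviProjection F (id : Fin n → Fin n))) (rootDeltaChar (standardParabolicGL F (id : Fin n → Fin n)))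
        ⟨u, upperUnitriangular_le_borel hu⟩ = 1 := by
  have hker : (⟨u, upperUnitriangular_le_borel hu⟩ : ↥(standardParabolicGL F (id : Fin n → Fin n))) ∈ unipotentRadicalP F (id : Fin n → Fin n) := by
    rw [← unipotentRadicalGL_subgroupOf, Subgroup.mem_subgroupOf]
    exact hu
  apply LinearMap.ext
  intro z
  rw [Representation.twist_apply, rootDeltaChar_eq_one_of_mem_unipotentRadicalP (hu := hker), MonoidHom.comp_apply, Representation.twist_apply,
    (MonoidHom.mem_ker).1 hker, map_one, Representation.trivial_apply, Units.val_one, one_smul, one_smul, Module.End.one_apply]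

/-- **CASE A value**: for `w⁻¹ i < w⁻¹ j` and ANY `f ∈ Ind_B σ′`, `f(P_w u_{ij}(x) P_s) = f(P_{s w})`. [cite: IwahoriMatsumoto1965, §3] [cite: Casselman1980, §3] -/
theorem toFun_permGL_mul_transvectionUnit_mul_permGL_swap_of_lt (w : Equiv.Perm (Fin n)) {i j : Fin n} (hij : i ≠ j) (hw : w⁻¹ i < w⁻¹ j) (x : F)
    (f : Representation.SmoothInd (standardParabolicGL F (id : Fin n → Fin n))
      (Representation.twist (((Representation.trivial ℂ (Π a : Fin n, GL {i : Fin n // (id : Fin n → Fin n) i = a} F) ℂ).twist χ).comp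
        (leviProjection F (id : Fin n → Fin n))) (rootDeltaChar (standardParabolicGL F (id : Fin n → Fin n))))) :
    f.toFun ((permGL w : GL (Fin n) F) * transvectionUnit i j hij x * permGL (Equiv.swap i j)) = f.toFun (permGL (Equiv.swap i j * w)) := by
  rw [permGL_mul_transvectionUnit_mul_permGL_swap_of_lt w hij x]
  have hu := transvectionUnit_mem_upperUnitriangular hw x
  have e := f.toFun_subgroup_mul ⟨_, upperUnitriangular_le_borel hu⟩ (permGL (Equiv.swap i j * w))
  rw [Subgroup.coe_mk] at e
  rw [e, inducingChar_eq_one_of_mem_upperUnitriangular χ hu, Module.End.one_apply]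

/-- **CASE B value**: for `w⁻¹ j < w⁻¹ i`, `x ∈ 𝒪ˣ` and `f ∈ (Ind_B σ′)^{Iw}`, `f(P_w u_{ij}(x) P_s) = f(P_w)` (`i < j`; `κ(x) ∈ Iw` is absorbed on the right, the `U`-factor on the left).
[cite: IwahoriMatsumoto1965, §3] [cite: Casselman1980, §3] [cite: BruhatTits1972, (4.4.4)] -/
theorem toFun_permGL_mul_transvectionUnit_mul_permGL_swap_of_gt (w : Equiv.Perm (Fin n)) {i j : Fin n} (hij : i < j) (hw : w⁻¹ j < w⁻¹ i)
    {x : F} (hx : valuation F x = 1)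
    {f : Representation.SmoothInd (standardParabolicGL F (id : Fin n → Fin n))
      (Representation.twist (((Representation.trivial ℂ (Π a : Fin n, GL {i : Fin n // (id : Fin n → Fin n) i = a} F) ℂ).twist χ).comp
        (leviProjection F (id : Fin n → Fin n))) (rootDeltaChar (standardParabolicGL F (id : Fin n → Fin n))))}
    (hf : f ∈ (Representation.parabolicIndGL F (id : Fin n → Fin n)
      ((Representation.trivial ℂ (Π a : Fin n, GL {i : Fin n // (id : Fin n → Fin n) i = a} F) ℂ).twist χ)).fixedPoints (iwahoriGL n F)) :
    f.toFun ((permGL w : GL (Fin n) F) * transvectionUnit i j hij.ne x * permGL (Equiv.swap i j)) = f.toFun (permGL w) := by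
  rw [permGL_mul_transvectionUnit_mul_permGL_swap_eq_rankOne w hij.ne, mul_assoc]
  have hu := transvectionUnit_mem_upperUnitriangular hw x⁻¹
  have e := f.toFun_subgroup_mul ⟨_, upperUnitriangular_le_borel hu⟩
    (permGL w * (transvectionUnit j i hij.ne' (-x⁻¹) * transvectionUnit i j hij.ne x * permGL (Equiv.swap i j)))
  rw [Subgroup.coe_mk] at e
  rw [e, inducingChar_eq_one_of_mem_upperUnitriangular χ hu, Module.End.one_apply, ← Representation.toFun_smoothIndRep_apply]
  exact congrArg (fun g => Representation.SmoothInd.toFun g (permGL w))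
    ((Representation.mem_fixedPoints _ _ _).1 hf _ (kappa_mem_iwahori hij hx))

/-- **Torus-move value**: `f(P_w diag(d) P_c) = σ′(diag(d ∘ w)) · f(P_{c w})` for any `f ∈ Ind_B σ′`. [cite: IwahoriMatsumoto1965, §3] [cite: Casselman1980, §3] -/
theorem toFun_permGL_mul_diagonalGL_mul_permGL (w c : Equiv.Perm (Fin n)) (d : Fin n → Fˣ)
    (f : Representation.SmoothInd (standardParabolicGL F (id : Fin n → Fin n))
      (Representation.twist (((Representation.trivial ℂ (Π a : Fin n, GL {i : Fin n // (id : Fin n → Fin n) i = a} F) ℂ).twist χ).comp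
        (leviProjection F (id : Fin n → Fin n))) (rootDeltaChar (standardParabolicGL F (id : Fin n → Fin n))))) :
    f.toFun ((permGL w : GL (Fin n) F) * diagonalGL (Fin n) F d * permGL c) =
      Representation.twist (((Representation.trivial ℂ (Π a : Fin n, GL {i : Fin n // (id : Fin n → Fin n) i = a} F) ℂ).twist χ).comp
        (leviProjection F (id : Fin n → Fin n))) (rootDeltaChar (standardParabolicGL F (id : Fin n → Fin n)))
          ⟨diagonalGL (Fin n) F (d ∘ w), diagonalGL_mem_borel _⟩ (f.toFun (permGL (c * w))) := by
  rw [permGL_mul_diagonalGL_mul_permGL]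
  have e := f.toFun_subgroup_mul ⟨diagonalGL (Fin n) F (d ∘ w), diagonalGL_mem_borel _⟩ (permGL (c * w))
  rw [Subgroup.coe_mk] at e
  exact e
end Values

/-! ## §4 The transversal `{u_{i,i+1}(x̃) : x ∈ 𝓀}` of `Iw ∕ (Iw ∩ P_s Iw P_s⁻¹)` -/

section Transversal
variable {F : Type u} [Field F] [ValuativeRel F] {n : ℕ}
/-- Membership in `Iw ∩ P_s Iw P_s⁻¹` (spelled `Iw ⊓ Iw.map (conj P_s)`): `m ∈ Iw` and `P_s⁻¹ m P_s ∈ Iw`. [cite: IwahoriMatsumoto1965, §3] -/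
theorem mem_inf_map_conj_iff (s : Equiv.Perm (Fin n)) (m : GL (Fin n) F) :
    m ∈ iwahoriGL n F ⊓ (iwahoriGL n F).map (MulAut.conj (permGL s : GL (Fin n) F)).toMonoidHom ↔
      m ∈ iwahoriGL n F ∧ (permGL s : GL (Fin n) F)⁻¹ * m * permGL s ∈ iwahoriGL n F := by
  rw [Subgroup.mem_inf, Subgroup.mem_map_equiv, MulAut.conj_symm_apply]

omit [ValuativeRel F] in
/-- The entry `(i, j)` of `u_{ij}(y)⁻¹ k = u_{ij}(−y) k` is `k_{ij} − y k_{jj}`. [folklore] -/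
theorem transvectionUnit_inv_mul_apply {i j : Fin n} (hij : i ≠ j) (y : F) (k : GL (Fin n) F) :
    (((transvectionUnit i j hij y)⁻¹ * k : GL (Fin n) F) : Matrix (Fin n) (Fin n) F) i j =
      (k : Matrix (Fin n) (Fin n) F) i j - y * (k : Matrix (Fin n) (Fin n) F) j j := by
  rw [transvectionUnit_inv, Units.val_mul, coe_transvectionUnit, ← Matrix.transvection, Matrix.transvection_mul_apply_same]
  ring

/-- **The coset of `k ∈ Iw` modulo `Iw ∩ P_s Iw P_s⁻¹` is read off the residue `k_{ij} ∕ k_{jj} mod 𝓂`** (`s = (i, i+1)`): for `y ∈ 𝒪`,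
`u_{ij}(y)⁻¹ k ∈ Iw ∩ P_s Iw P_s⁻¹ ↔ residue (k_{ij}) = residue (y) · residue (k_{jj})`. [cite: IwahoriMatsumoto1965, §3] -/
theorem transvectionUnit_inv_mul_mem_inf_iff {i j : Fin n} (hij : (j : ℕ) = i + 1) {k : GL (Fin n) F} (hk : k ∈ iwahoriGL n F)
    {y : F} (hy : y ∈ 𝒪[F]) :
    (transvectionUnit i j (Fin.ne_of_lt (Fin.lt_def.2 (by omega))) y)⁻¹ * k ∈
        iwahoriGL n F ⊓ (iwahoriGL n F).map (MulAut.conj (permGL (Equiv.swap i j) : GL (Fin n) F)).toMonoidHom ↔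
      IsLocalRing.residue 𝒪[F] ⟨(k : Matrix (Fin n) (Fin n) F) i j, apply_mem_integer_of_mem_glInt (iwahoriGL_le_glInt n F hk) i j⟩ =
        IsLocalRing.residue 𝒪[F] ⟨y, hy⟩ * IsLocalRing.residue 𝒪[F] ⟨(k : Matrix (Fin n) (Fin n) F) j j, apply_mem_integer_of_mem_glInt (iwahoriGL_le_glInt n F hk) j j⟩ := by
  have hij' : i < j := Fin.lt_def.2 (by omega)
  have hmem : (transvectionUnit i j hij'.ne y)⁻¹ * k ∈ iwahoriGL n F :=
    mul_mem (inv_mem (transvectionUnit_mem_iwahori hij' hy)) hk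
  rw [mem_inf_map_conj_iff, and_iff_right hmem, conj_swap_mem_iwahori_iff hij hmem, transvectionUnit_inv_mul_apply,
    ← residue_eq_zero_iff_valuation_lt_one ⟨_, sub_mem (apply_mem_integer_of_mem_glInt (iwahoriGL_le_glInt n F hk) i j)
      (mul_mem hy (apply_mem_integer_of_mem_glInt (iwahoriGL_le_glInt n F hk) j j))⟩]
  have hsub : (⟨(k : Matrix (Fin n) (Fin n) F) i j - y * (k : Matrix (Fin n) (Fin n) F) j j, sub_mem (apply_mem_integer_of_mem_glInt (iwahoriGL_le_glInt n F hk) i j)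
      (mul_mem hy (apply_mem_integer_of_mem_glInt (iwahoriGL_le_glInt n F hk) j j))⟩ : 𝒪[F]) =
      ⟨(k : Matrix (Fin n) (Fin n) F) i j, apply_mem_integer_of_mem_glInt (iwahoriGL_le_glInt n F hk) i j⟩ -
        ⟨y, hy⟩ * ⟨(k : Matrix (Fin n) (Fin n) F) j j, apply_mem_integer_of_mem_glInt (iwahoriGL_le_glInt n F hk) j j⟩ := rfl
  rw [hsub, map_sub, map_mul, sub_eq_zero]

open scoped Classical in
/-- **`R₀ = {u_{i,i+1}(x̃) : x ∈ 𝓀}` IS A LEFT TRANSVERSAL OF `Iw ∕ (Iw ∩ P_s Iw P_s⁻¹)`** (★ `IsLeftTransversal`): the `q = |𝓀|` left `Iw`-cosets in `Iw s Iw`.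
[cite: IwahoriMatsumoto1965, §3 (Prop. 3.2)] [cite: BruhatTits1972, (4.4.3)] -/
theorem isLeftTransversal_iwahori_swap [Fintype 𝓀[F]] {i j : Fin n} (hij : (j : ℕ) = i + 1) :
    IsLeftTransversal (iwahoriGL n F)
      (iwahoriGL n F ⊓ (iwahoriGL n F).map (MulAut.conj (permGL (Equiv.swap i j) : GL (Fin n) F)).toMonoidHom)
      (Finset.univ.image fun a : 𝓀[F] => transvectionUnit i j (Fin.ne_of_lt (Fin.lt_def.2 (by omega))) ((liftRes a : 𝒪[F]) : F)) := by
  classical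
  have hij' : i < j := Fin.lt_def.2 (by omega)
  refine ⟨fun r hr => ?_, fun k hk => ?_⟩
  · obtain ⟨a, -, rfl⟩ := Finset.mem_image.1 hr
    exact transvectionUnit_mem_iwahori hij' (liftRes a).2
  · -- the residue `a₀ = k̄_{ij} ∕ k̄_{jj}` (the denominator is a unit)
    have hjj : IsLocalRing.residue 𝒪[F] ⟨(k : Matrix (Fin n) (Fin n) F) j j, apply_mem_integer_of_mem_glInt (iwahoriGL_le_glInt n F hk) j j⟩ ≠ 0 := by
      rw [Ne, residue_eq_zero_iff_valuation_lt_one, not_lt]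
      exact (valuation_apply_diag_eq_one_of_mem_iwahori hk j).ge
    set a₀ := IsLocalRing.residue 𝒪[F] ⟨(k : Matrix (Fin n) (Fin n) F) i j, apply_mem_integer_of_mem_glInt (iwahoriGL_le_glInt n F hk) i j⟩ *
      (IsLocalRing.residue 𝒪[F] ⟨(k : Matrix (Fin n) (Fin n) F) j j, apply_mem_integer_of_mem_glInt (iwahoriGL_le_glInt n F hk) j j⟩)⁻¹ with ha₀
    have key : ∀ a : 𝓀[F], (transvectionUnit i j hij'.ne ((liftRes a : 𝒪[F]) : F))⁻¹ * k ∈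
        iwahoriGL n F ⊓ (iwahoriGL n F).map (MulAut.conj (permGL (Equiv.swap i j) : GL (Fin n) F)).toMonoidHom ↔ a = a₀ := by
      intro a
      rw [transvectionUnit_inv_mul_mem_inf_iff hij hk (liftRes a).2]
      have : IsLocalRing.residue 𝒪[F] ⟨((liftRes a : 𝒪[F]) : F), (liftRes a).2⟩ = a := by
        rw [Subtype.coe_eta]; exact residue_liftRes a
      rw [this, ha₀, eq_mul_inv_iff_mul_eq₀ hjj]
      exact eq_comm
    refine ⟨transvectionUnit i j hij'.ne ((liftRes a₀ : 𝒪[F]) : F), ⟨Finset.mem_image.2 ⟨a₀, Finset.mem_univ _, rfl⟩, (key a₀).2 rfl⟩, ?_⟩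
    rintro r ⟨hr, hrk⟩
    obtain ⟨a, -, rfl⟩ := Finset.mem_image.1 hr
    rw [(key a).1 hrk]

/-- The map `x ↦ u_{ij}(x̃)` is injective on `𝓀` (its `(i, j)` entry is `x̃`, and `x̃` determines `x`). [folklore] -/
theorem transvectionUnit_liftRes_injective {i j : Fin n} (hij : i ≠ j) :
    Function.Injective fun a : 𝓀[F] => transvectionUnit i j hij ((liftRes a : 𝒪[F]) : F) := by
  intro a b hab
  have h := congrArg (fun g : GL (Fin n) F => (g : Matrix (Fin n) (Fin n) F) i j) hab
  simp only [coe_transvectionUnit, Matrix.add_apply, Matrix.one_apply_ne hij, Matrix.single_apply_same, zero_add] at h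
  rw [← residue_liftRes a, ← residue_liftRes b, Subtype.ext h]

open scoped Classical in
/-- **`#R₀ = q`**: the transversal has `|𝓀| = residueFieldCard F` elements. [cite: IwahoriMatsumoto1965, §3 (Prop. 3.2)] -/
theorem card_transversal_eq [Fintype 𝓀[F]] {i j : Fin n} (hij : i ≠ j) :
    (Finset.univ.image fun a : 𝓀[F] => transvectionUnit i j hij ((liftRes a : 𝒪[F]) : F)).card = Nat.card 𝓀[F] := by
  rw [Finset.card_image_of_injective _ (transvectionUnit_liftRes_injective hij), Finset.card_univ, Nat.card_eq_fintype_card]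
end Transversal

end Summit.HodgeConjecture.HodgeConjecture.Cruxes.H413.K2E3GLnIwahoriHeckeCells

end
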